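/-
Copyright (c) 2026. All rights reserved.
Released under Apache 2.0 license as described in the file LICENSE.
-/
import Mathlib.Analysis.Matrix.Spectrum
import Mathlib.Algebra.BigOperators.Ring.Finset
import Mathlib.Data.Fintype.BigOperators
import HarnessLib

/-!
# A Hermitian matrix with spectrum in `[0,1]` is a convex combination of its spectral projections
# (product-Bernoulli form)

Topic `MathematicalPhysics/QuantumLattice`, family `hubbard` (the finite-dimensional core of Lieb's
variational principle for generalised Hartree–Fock states: a one-body density matrix
`0 ≤ γ ≤ 1` is an average of Slater projections). For a Hermitian matrix `A = U diag(λ) Uᴴ`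
(Mathlib's `Matrix.IsHermitian.eigenvectorUnitary` / `eigenvalues`) and every `ε : n → Bool` put

* `bernoulliProj hA ε := U · diag[ε i] · Uᴴ` — the spectral projection onto the eigenvectors
  selected by `ε` (Hermitian, idempotent, trace `#{i | ε i}`);
* `bernoulliWeight hA ε := Π_i (if ε i then λ_i else 1 - λ_i)` — the product-Bernoulli weight.

Then, with NO ordering of the eigenvalues and no majorisation argument,

* `sum_bernoulliWeight : Σ_ε w(ε) = 1` (`Finset.prod_univ_sum`),
* `sum_bernoulliWeight_mul_indicator : Σ_ε w(ε) · [ε i] = λ_i` (the marginal of a product measure),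
* **`sum_bernoulliWeight_smul_bernoulliProj : Σ_ε w(ε) • F_ε = A`** (always, for any real
  spectrum), and `bernoulliWeight_nonneg` when every `λ_i ∈ [0,1]`.

So a Hermitian `A` with eigenvalues in `[0,1]` is the convex combination `Σ_ε w(ε) F_ε` of the
`2^n` orthogonal projections `F_ε`, each commuting with `A`, with `tr F_ε = #{i | ε i}`.
This is the decomposition used to pass Hartree–Fock-type energy bounds from Slater projections to
arbitrary one-body density matrices `0 ≤ γ ≤ 1` (the energy functional being affine in `γ` along
the decomposition). Everything is proved; the two definitions have bodies; no named facts.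

## Mathlib / tree search

Mathlib (REUSED): `Matrix.IsHermitian.spectral_theorem`, `eigenvectorUnitary`,
`Unitary.coe_star_mul_self`, `Matrix.isHermitian_mul_mul_conjTranspose`, `Matrix.trace_mul_comm`,
`Finset.prod_univ_sum`, `Fintype.piFinset_univ`, `Finset.sum_boole`. Tree: `HartreeFock.fermiProj`
(`HartreeFockFermiProjection.lean`) is the special case `ε i = [λ_i < μ]`; no convex decomposition
of a sub-projection one-body matrix existed (`lean search 'convex combination|Bernoulli|hypersimplex'`).

## References

* E. H. Lieb, *Variational principle for many-fermion systems*, Phys. Rev. Lett. 46 (1981) 457–459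
  (the HF functional over `0 ≤ γ ≤ 1`, `tr γ = N`, is minimised on projections). [Lieb1981]
* V. Bach, E. H. Lieb, J. P. Solovej, J. Stat. Phys. 76 (1994) 3, Thm 3.10. [BachLiebSolovej1994]
-/

noncomputable section

namespace Literature.MathematicalPhysics.QuantumLattice

namespace HartreeFock

open Matrix Finset

variable {n : Type*} [Fintype n] [DecidableEq n] {A : Matrix n n ℂ}

/-- The spectral `0/1`-projection of a Hermitian matrix selected by `ε : n → Bool`:
`U · diag[ε i] · Uᴴ` in Mathlib's eigenvector unitary `U`. [cite: BachLiebSolovej1994, Thm 3.10] -/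
def bernoulliProj (hA : A.IsHermitian) (ε : n → Bool) : Matrix n n ℂ :=
  (hA.eigenvectorUnitary : Matrix n n ℂ) *
    diagonal (fun i => if ε i then (1 : ℂ) else 0) * (hA.eigenvectorUnitary : Matrix n n ℂ)ᴴ

/-- The product-Bernoulli weight of `ε`: `Π_i (if ε i then λ_i else 1 - λ_i)` with `λ` the
eigenvalues of `A`. [cite: Lieb1981, eq. (4)] -/
def bernoulliWeight (hA : A.IsHermitian) (ε : n → Bool) : ℝ :=
  ∏ i, (if ε i then hA.eigenvalues i else 1 - hA.eigenvalues i)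

omit [Fintype n] [DecidableEq n] in
/-- `Uᴴ U = 1` for the eigenvector unitary. [folklore] -/
private theorem star_coe_mul_coe [Fintype n] [DecidableEq n] (hA : A.IsHermitian) :
    (hA.eigenvectorUnitary : Matrix n n ℂ)ᴴ * (hA.eigenvectorUnitary : Matrix n n ℂ) = 1 := by
  rw [← Matrix.star_eq_conjTranspose]
  exact Unitary.coe_star_mul_self hA.eigenvectorUnitary

/-- `F_ε` is Hermitian (a spectral projection of `A`). [cite: BachLiebSolovej1994, Thm 3.10] -/
theorem isHermitian_bernoulliProj (hA : A.IsHermitian) (ε : n → Bool) :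
    (bernoulliProj hA ε).IsHermitian := by
  unfold bernoulliProj
  refine Matrix.isHermitian_mul_mul_conjTranspose _ (isHermitian_diagonal_iff.2 fun i => ?_)
  rw [isSelfAdjoint_iff]
  split_ifs <;> simp

/-- `F_ε` is idempotent (a spectral projection of `A`). [cite: BachLiebSolovej1994, Thm 3.10] -/
theorem bernoulliProj_mul_self (hA : A.IsHermitian) (ε : n → Bool) :
    bernoulliProj hA ε * bernoulliProj hA ε = bernoulliProj hA ε := by
  unfold bernoulliProj
  set U : Matrix n n ℂ := (hA.eigenvectorUnitary : Matrix n n ℂ) with hU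
  set D : Matrix n n ℂ := diagonal (fun i => if ε i then (1 : ℂ) else 0) with hD
  have hUU : Uᴴ * U = 1 := star_coe_mul_coe hA
  have hDD : D * D = D := by
    rw [hD, diagonal_mul_diagonal]
    congr 1
    funext i
    split_ifs <;> simp
  calc U * D * Uᴴ * (U * D * Uᴴ) = U * (D * ((Uᴴ * U) * (D * Uᴴ))) := by
        simp only [Matrix.mul_assoc]
    _ = U * D * Uᴴ := by rw [hUU, Matrix.one_mul, ← Matrix.mul_assoc D, hDD, Matrix.mul_assoc]

/-- `tr F_ε = #{i | ε i}` (the rank of the spectral projection). [cite: BachLiebSolovej1994, Thm 3.10] -/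
theorem trace_bernoulliProj (hA : A.IsHermitian) (ε : n → Bool) :
    (bernoulliProj hA ε).trace = ((Finset.univ.filter fun i => ε i = true).card : ℂ) := by
  unfold bernoulliProj
  rw [Matrix.trace_mul_comm, ← Matrix.mul_assoc, star_coe_mul_coe hA, Matrix.one_mul,
    trace_diagonal]
  rw [show (fun i => if ε i then (1 : ℂ) else 0) = fun i => if ε i = true then (1 : ℂ) else 0 from rfl,
    Finset.sum_boole]

/-- The weights are nonnegative when the spectrum lies in `[0,1]`. [cite: Lieb1981, eq. (4)] -/
theorem bernoulliWeight_nonneg (hA : A.IsHermitian) (h0 : ∀ i, 0 ≤ hA.eigenvalues i)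
    (h1 : ∀ i, hA.eigenvalues i ≤ 1) (ε : n → Bool) : 0 ≤ bernoulliWeight hA ε := by
  unfold bernoulliWeight
  refine Finset.prod_nonneg fun i _ => ?_
  split_ifs
  · exact h0 i
  · linarith [h1 i]

/-- A product over `n` of a two-valued choice summed over all `ε : n → Bool` is the product of the
sums: `Σ_ε Π_i f i (ε i) = Π_i (f i true + f i false)`. [folklore] -/
private theorem sum_prod_bool (f : n → Bool → ℝ) :
    ∑ ε : n → Bool, ∏ i, f i (ε i) = ∏ i, (f i true + f i false) := by
  have h := Finset.prod_univ_sum (fun _ : n => (Finset.univ : Finset Bool)) f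
  rw [Fintype.piFinset_univ] at h
  rw [← h]
  refine Finset.prod_congr rfl fun i _ => ?_
  rw [Fintype.sum_bool]

/-- **The weights sum to one.** [cite: Lieb1981, eq. (4)] -/
theorem sum_bernoulliWeight (hA : A.IsHermitian) : ∑ ε : n → Bool, bernoulliWeight hA ε = 1 := by
  unfold bernoulliWeight
  rw [sum_prod_bool (fun i b => if b then hA.eigenvalues i else 1 - hA.eigenvalues i)]
  simp

/-- **Marginals of the product measure**: `Σ_ε w(ε) · [ε i] = λ_i`. [cite: Lieb1981, eq. (4)] -/
theorem sum_bernoulliWeight_mul_indicator (hA : A.IsHermitian) (i : n) :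
    ∑ ε : n → Bool, bernoulliWeight hA ε * (if ε i then 1 else 0) = hA.eigenvalues i := by
  unfold bernoulliWeight
  -- absorb the indicator into the `i`-th factor
  have hfac : ∀ ε : n → Bool,
      (∏ j, (if ε j then hA.eigenvalues j else 1 - hA.eigenvalues j)) * (if ε i then 1 else 0) =
        ∏ j, (if j = i then (if ε j then hA.eigenvalues j else 0)
              else (if ε j then hA.eigenvalues j else 1 - hA.eigenvalues j)) := by
    intro ε
    rw [← Finset.mul_prod_erase Finset.univ _ (Finset.mem_univ i),
      ← Finset.mul_prod_erase Finset.univ _ (Finset.mem_univ i)]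
    simp only [if_true]
    have hrest : ∏ j ∈ Finset.univ.erase i,
        (if j = i then (if ε j then hA.eigenvalues j else 0)
          else (if ε j then hA.eigenvalues j else 1 - hA.eigenvalues j)) =
        ∏ j ∈ Finset.univ.erase i, (if ε j then hA.eigenvalues j else 1 - hA.eigenvalues j) := by
      refine Finset.prod_congr rfl fun j hj => ?_
      rw [if_neg (Finset.ne_of_mem_erase hj)]
    rw [hrest]
    split_ifs <;> ring
  simp_rw [hfac]
  rw [sum_prod_bool (fun j b => if j = i then (if b then hA.eigenvalues j else 0)
    else (if b then hA.eigenvalues j else 1 - hA.eigenvalues j))]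
  rw [Finset.prod_congr rfl (g := fun j => if j = i then hA.eigenvalues i else 1) (fun j _ => ?_)]
  · rw [Finset.prod_ite_eq']
    simp
  · by_cases h : j = i
    · subst h
      simp
    · simp only [h, ↓reduceIte, Bool.false_eq_true]
      ring

/-- **Product-Bernoulli decomposition of a Hermitian matrix**: `Σ_ε w(ε) • F_ε = A` (for any real
spectrum; with `bernoulliWeight_nonneg` and `sum_bernoulliWeight` this exhibits a Hermitian matrix
with eigenvalues in `[0,1]` as a convex combination of commuting orthogonal projections).
[cite: Lieb1981, eq. (4)][cite: BachLiebSolovej1994, Thm 3.10] -/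
theorem sum_bernoulliWeight_smul_bernoulliProj (hA : A.IsHermitian) :
    ∑ ε : n → Bool, ((bernoulliWeight hA ε : ℝ) : ℂ) • bernoulliProj hA ε = A := by
  set U : Matrix n n ℂ := (hA.eigenvectorUnitary : Matrix n n ℂ) with hU
  have hlin : ∑ ε : n → Bool, ((bernoulliWeight hA ε : ℝ) : ℂ) • bernoulliProj hA ε =
      U * diagonal (fun i => ∑ ε : n → Bool,
        ((bernoulliWeight hA ε : ℝ) : ℂ) * (if ε i then (1 : ℂ) else 0)) * Uᴴ := by
    unfold bernoulliProj
    rw [← hU]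
    have : (diagonal fun i => ∑ ε : n → Bool,
        ((bernoulliWeight hA ε : ℝ) : ℂ) * (if ε i then (1 : ℂ) else 0)) =
        ∑ ε : n → Bool, ((bernoulliWeight hA ε : ℝ) : ℂ) • diagonal (fun i => if ε i then (1 : ℂ) else 0) := by
      ext a b
      simp only [diagonal_apply, Matrix.sum_apply, Matrix.smul_apply, smul_eq_mul]
      split_ifs <;> simp
    rw [this, Finset.mul_sum, Finset.sum_mul]
    refine Finset.sum_congr rfl fun ε _ => ?_
    rw [Matrix.mul_smul, Matrix.smul_mul]
  rw [hlin]
  have hdiag : (diagonal fun i => ∑ ε : n → Bool,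
      ((bernoulliWeight hA ε : ℝ) : ℂ) * (if ε i then (1 : ℂ) else 0)) =
      diagonal (RCLike.ofReal ∘ hA.eigenvalues) := by
    congr 1
    funext i
    have h := sum_bernoulliWeight_mul_indicator hA i
    have hcast : ∑ ε : n → Bool, ((bernoulliWeight hA ε : ℝ) : ℂ) * (if ε i then (1 : ℂ) else 0) =
        ((∑ ε : n → Bool, bernoulliWeight hA ε * (if ε i then 1 else 0) : ℝ) : ℂ) := by
      push_cast
      refine Finset.sum_congr rfl fun ε _ => ?_
      split_ifs <;> simp
    rw [hcast, h]
    rfl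
  rw [hdiag]
  conv_rhs => rw [hA.spectral_theorem, Unitary.conjStarAlgAut_apply]
  rw [hU, Matrix.star_eq_conjTranspose]

/-- The mean particle number of the decomposition: `Σ_ε w(ε) · #{i | ε i} = Σ_i λ_i (= re tr A)`.
[cite: Lieb1981, eq. (4)] -/
theorem sum_bernoulliWeight_mul_card (hA : A.IsHermitian) :
    ∑ ε : n → Bool, bernoulliWeight hA ε * ((Finset.univ.filter fun i => ε i = true).card : ℝ) =
      ∑ i, hA.eigenvalues i := by
  have hcard : ∀ ε : n → Bool, ((Finset.univ.filter fun i => ε i = true).card : ℝ) =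
      ∑ i, (if ε i then (1 : ℝ) else 0) := by
    intro ε
    rw [show (fun i => if ε i then (1 : ℝ) else 0) = fun i => if ε i = true then (1 : ℝ) else 0 from rfl,
      Finset.sum_boole]
  simp_rw [hcard, Finset.mul_sum]
  rw [Finset.sum_comm]
  exact Finset.sum_congr rfl fun i _ => sum_bernoulliWeight_mul_indicator hA i

end HartreeFock

end Literature.MathematicalPhysics.QuantumLattice
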